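import Mathlib
import Summits.NavierStokesRegularity.NavierStokesRegularity.Theorems.EulerZoomLiouvillePowerGaugeEulerLiouvilleGradientTest

/-!
# R49 plate t52-RV: the RADIAL VIRIAL IDENTITY (nsreg-p2 ROUND-49 «EVERY BALL BREATHES», `NsregP2.R49.RadialVirialIdentity`,
text VERBATIM from `r49/Sketch49.lean` l.69–78; seat ns-ezl-w2 g5, `--supports stmt-NavierStokesRegularity-19832 --as helper`)

For a `γ`-profile `(V, P)` with any centre, every point `x₀` and every weight `ψ ∈ C¹_c(ℝ)` evaluated at `‖z‖²`, `z = y − x₀`: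
`∫ ( ψ(‖z‖²)‖V‖² + 2ψ′(‖z‖²)⟪V, z⟫² + P (3ψ(‖z‖²) + 2‖z‖²ψ′(‖z‖²)) ) dy = 0`.
Proof: `ClassicalProfile.gradientTestIdentity` (t52-GT) with the radial test function `X(y) = ½Ψ(‖y − x₀‖²)`, `Ψ′ = ψ`, `Ψ = 0`
beyond the support of `ψ` (`Ψ(s) = ∫_{M+1}^s ψ`); then `∇X = ψ(‖z‖²) z`, `D(∇X)[V] = ψ V + 2ψ′⟪z, V⟫ z`, `div ∇X = 3ψ + 2‖z‖²ψ′`.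

HONEST FRAMING: whole-space integration by parts (a ROUND-49 instrument statement); nothing about the crux E (19832 OPEN) or NS
regularity. [cite: ChaeWolf2016, §2 (radial tests); nsreg-p2 R49 §1.2; folklore]
-/

noncomputable section

set_option linter.dupNamespace false

open MeasureTheory Set Filter Topology Metric Function TopologicalSpace
open scoped ENNReal NNReal RealInnerProductSpace ContDiff Laplacian

namespace Summit.NavierStokesRegularity.NavierStokesRegularity.Theorems.PowerGaugeEulerLiouville

open Literature.Analysis Literature.Analysis.FunctionSpaces Literature.Analysis.FluidPDE

namespace ClassicalProfile

/-- **The radial test function.**  For `ψ ∈ C¹_c(ℝ)` there is `X ∈ C²_c(ℝ³)` with `∇X(y) = ψ(‖y − x₀‖²) (y − x₀)`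
(`X(y) = ½Ψ(‖y − x₀‖²)`, `Ψ` the primitive of `ψ` vanishing to the right of the support). [folklore] -/
theorem exists_radial_test {ψ : ℝ → ℝ} (hψ : ContDiff ℝ 1 ψ) (hψc : HasCompactSupport ψ) (x₀ : EuclideanSpace ℝ (Fin 3)) :
    ∃ X : EuclideanSpace ℝ (Fin 3) → ℝ, ContDiff ℝ 2 X ∧ HasCompactSupport X ∧
      ∀ y, HasGradientAt X (ψ (‖y - x₀‖ ^ 2) • (y - x₀)) y := by
  -- a bound for the support of `ψ`
  obtain ⟨M₀, hM₀⟩ := (Metric.isBounded_iff_subset_closedBall (0 : ℝ)).1 hψc.isCompact.isBounded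
  set M : ℝ := max M₀ 0 with hM
  have hzero : ∀ s, M < s → ψ s = 0 := by
    intro s hs
    apply image_eq_zero_of_notMem_tsupport
    intro hmem
    have h := hM₀ hmem
    rw [Metric.mem_closedBall, dist_zero_right, Real.norm_eq_abs] at h
    have : s ≤ M := (le_abs_self s).trans (h.trans (le_max_left _ _))
    linarith
  -- the primitive `Ψ(s) = ∫_{M+1}^s ψ`
  set Ψ : ℝ → ℝ := fun s => ∫ t in (M + 1)..s, ψ t with hΨ
  have hΨ' : ∀ s, HasDerivAt Ψ (ψ s) s := fun s => (hψ.continuous.integral_hasStrictDerivAt (M + 1) s).hasDerivAt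
  have hΨd : Differentiable ℝ Ψ := fun s => (hΨ' s).differentiableAt
  have hderiv : deriv Ψ = ψ := funext fun s => (hΨ' s).deriv
  have hΨ2 : ContDiff ℝ 2 Ψ := by
    rw [show (2 : WithTop ℕ∞) = 1 + 1 from rfl, contDiff_succ_iff_deriv]
    exact ⟨hΨd, fun h => absurd h (by simp), by rw [hderiv]; exact hψ⟩
  have hΨzero : ∀ s, M + 1 ≤ s → Ψ s = 0 := by
    intro s hs
    show ∫ t in (M + 1)..s, ψ t = 0
    rw [intervalIntegral.integral_congr (g := fun _ => (0 : ℝ)) fun t ht => ?_]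
    · simp
    · rw [uIcc_of_le hs] at ht
      exact hzero t (by linarith [ht.1])
  -- `X(y) = ½ Ψ(‖y − x₀‖²)`
  refine ⟨fun y => (1 / 2 : ℝ) * Ψ (‖y - x₀‖ ^ 2), ?_, ?_, ?_⟩
  · exact contDiff_const.mul (hΨ2.comp ((contDiff_norm_sq ℝ).comp (contDiff_id.sub contDiff_const)))
  · refine HasCompactSupport.intro (isCompact_closedBall x₀ (M + 2)) fun y hy => ?_
    rw [Metric.mem_closedBall, dist_eq_norm, not_le] at hy
    have h1 : M + 1 ≤ ‖y - x₀‖ ^ 2 := by nlinarith [le_max_right M₀ 0]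
    show (1 / 2 : ℝ) * Ψ (‖y - x₀‖ ^ 2) = 0
    rw [hΨzero _ h1, mul_zero]
  · intro y
    have hn : HasFDerivAt (fun y : EuclideanSpace ℝ (Fin 3) => ‖y - x₀‖ ^ 2)
        ((2 : ℕ) • (innerSL ℝ (y - x₀)).comp (ContinuousLinearMap.id ℝ (EuclideanSpace ℝ (Fin 3)))) y :=
      ((hasFDerivAt_id y).sub_const x₀).norm_sq
    have h1 := ((hΨ' (‖y - x₀‖ ^ 2)).comp_hasFDerivAt y hn).const_mul (1 / 2 : ℝ)
    rw [hasGradientAt_iff_hasFDerivAt]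
    refine h1.congr_fderiv ?_
    ext v
    rw [two_nsmul] at *
    simp only [_root_.smul_apply, _root_.add_apply, ContinuousLinearMap.comp_apply, ContinuousLinearMap.id_apply,
      innerSL_apply_apply, smul_eq_mul, InnerProductSpace.toDual_apply_apply, real_inner_smul_left]
    ring

/-- **RADIAL VIRIAL IDENTITY** (`NsregP2.R49.RadialVirialIdentity γ`, text verbatim): see the module docstring.
[cite: ChaeWolf2016, §2; nsreg-p2 R49 §1.2; folklore] -/
theorem radialVirialIdentity (γ : ℝ) :
    ∀ (c : EuclideanSpace ℝ (Fin 3)) (V : EuclideanSpace ℝ (Fin 3) → EuclideanSpace ℝ (Fin 3)) (P : EuclideanSpace ℝ (Fin 3) → ℝ),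
      IsSelfSimilarEulerProfile γ c V P →
      ∀ (x₀ : EuclideanSpace ℝ (Fin 3)) (ψ : ℝ → ℝ), ContDiff ℝ 1 ψ → HasCompactSupport ψ →
        ∫ y, (ψ (‖y - x₀‖ ^ 2) * ‖V y‖ ^ 2
                + 2 * deriv ψ (‖y - x₀‖ ^ 2) * ⟪V y, y - x₀⟫ ^ 2
                + P y * (3 * ψ (‖y - x₀‖ ^ 2) + 2 * ‖y - x₀‖ ^ 2 * deriv ψ (‖y - x₀‖ ^ 2))) = 0 := by
  intro c V P hprof x₀ ψ hψ hψc
  obtain ⟨X, hX, hXc, hgrad⟩ := exists_radial_test hψ hψc x₀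
  have hG : gradient X = fun y => ψ (‖y - x₀‖ ^ 2) • (y - x₀) := funext fun y => (hgrad y).gradient
  -- the differential of `∇X = ψ(‖z‖²) z`
  have hψd : ∀ s, HasDerivAt ψ (deriv ψ s) s := fun s => ((hψ.differentiable one_ne_zero) s).hasDerivAt
  have hDG : ∀ y w, fderiv ℝ (gradient X) y w =
      ψ (‖y - x₀‖ ^ 2) • w + (2 * deriv ψ (‖y - x₀‖ ^ 2) * ⟪y - x₀, w⟫) • (y - x₀) := by
    intro y w
    have hn : HasFDerivAt (fun y : EuclideanSpace ℝ (Fin 3) => ‖y - x₀‖ ^ 2)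
        ((2 : ℕ) • (innerSL ℝ (y - x₀)).comp (ContinuousLinearMap.id ℝ (EuclideanSpace ℝ (Fin 3)))) y :=
      ((hasFDerivAt_id y).sub_const x₀).norm_sq
    have hs : HasFDerivAt (fun y : EuclideanSpace ℝ (Fin 3) => ψ (‖y - x₀‖ ^ 2))
        (deriv ψ (‖y - x₀‖ ^ 2) • ((2 : ℕ) • (innerSL ℝ (y - x₀)).comp
          (ContinuousLinearMap.id ℝ (EuclideanSpace ℝ (Fin 3))))) y :=
      (hψd _).comp_hasFDerivAt y hn
    have hv : HasFDerivAt (fun y : EuclideanSpace ℝ (Fin 3) => y - x₀)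
        (ContinuousLinearMap.id ℝ (EuclideanSpace ℝ (Fin 3))) y := (hasFDerivAt_id y).sub_const x₀
    have h : HasFDerivAt (fun y : EuclideanSpace ℝ (Fin 3) => ψ (‖y - x₀‖ ^ 2) • (y - x₀))
        (ψ (‖y - x₀‖ ^ 2) • ContinuousLinearMap.id ℝ (EuclideanSpace ℝ (Fin 3)) +
          (deriv ψ (‖y - x₀‖ ^ 2) • ((2 : ℕ) • (innerSL ℝ (y - x₀)).comp
            (ContinuousLinearMap.id ℝ (EuclideanSpace ℝ (Fin 3))))).smulRight (y - x₀)) y := hs.smul hv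
    rw [hG, h.fderiv]
    rw [two_nsmul]
    simp only [_root_.add_apply, _root_.smul_apply, ContinuousLinearMap.smulRight_apply, ContinuousLinearMap.comp_apply,
      ContinuousLinearMap.id_apply, innerSL_apply_apply, smul_eq_mul]
    congr 1
    ring_nf
  -- the two integrands agree pointwise
  have hpt : ∀ y, ⟪V y, fderiv ℝ (gradient X) y (V y)⟫ + P y * VectorCalculus.divergence (gradient X) y =
      ψ (‖y - x₀‖ ^ 2) * ‖V y‖ ^ 2 + 2 * deriv ψ (‖y - x₀‖ ^ 2) * ⟪V y, y - x₀⟫ ^ 2 +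
        P y * (3 * ψ (‖y - x₀‖ ^ 2) + 2 * ‖y - x₀‖ ^ 2 * deriv ψ (‖y - x₀‖ ^ 2)) := by
    intro y
    have hdiv : VectorCalculus.divergence (gradient X) y =
        3 * ψ (‖y - x₀‖ ^ 2) + 2 * ‖y - x₀‖ ^ 2 * deriv ψ (‖y - x₀‖ ^ 2) := by
      rw [divergence_eq_sum_inner_fderiv (EuclideanSpace.basisFun (Fin 3) ℝ)]
      have hon : ∀ i, ⟪(EuclideanSpace.basisFun (Fin 3) ℝ) i, (EuclideanSpace.basisFun (Fin 3) ℝ) i⟫ = (1 : ℝ) := by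
        intro i
        have h := orthonormal_iff_ite.mp (EuclideanSpace.basisFun (Fin 3) ℝ).orthonormal i i
        rwa [if_pos rfl] at h
      have hsum := (EuclideanSpace.basisFun (Fin 3) ℝ).sum_inner_mul_inner (y - x₀) (y - x₀)
      rw [real_inner_self_eq_norm_sq] at hsum
      have hterm : ∀ i, ⟪(EuclideanSpace.basisFun (Fin 3) ℝ) i, fderiv ℝ (gradient X) y ((EuclideanSpace.basisFun (Fin 3) ℝ) i)⟫ =
          ψ (‖y - x₀‖ ^ 2) + 2 * deriv ψ (‖y - x₀‖ ^ 2) *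
            (⟪y - x₀, (EuclideanSpace.basisFun (Fin 3) ℝ) i⟫ * ⟪(EuclideanSpace.basisFun (Fin 3) ℝ) i, y - x₀⟫) := by
        intro i
        rw [hDG, inner_add_right, inner_smul_right, inner_smul_right, hon i]
        ring
      simp_rw [hterm]
      rw [Finset.sum_add_distrib, Finset.sum_const, Finset.card_univ, Fintype.card_fin, ← Finset.mul_sum, hsum, nsmul_eq_mul,
        Nat.cast_ofNat]
      ring
    rw [hdiv, hDG, inner_add_right, inner_smul_right, inner_smul_right, real_inner_self_eq_norm_sq, real_inner_comm (y - x₀)]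
    ring
  have h := gradientTestIdentity γ c V P hprof X hX hXc
  rw [integral_congr_ae (Eventually.of_forall hpt)] at h
  exact h

end ClassicalProfile

end Summit.NavierStokesRegularity.NavierStokesRegularity.Theorems.PowerGaugeEulerLiouville

end
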